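import Literature.NumberTheory.Transcendental.SiegelSystem
import Literature.NumberTheory.Transcendental.SiegelWrapper
import HarnessLib

/-!
# The auxiliary function of Baker's method on `M_κ` (Siegel step)

Topic: `Literature/NumberTheory/Transcendental`. Plan item W4/S4 (assembly) of the unit
`provefact-Literature.NumberTheory.Transcendental.H-b596640137`. With the field `K`, the entries
`entryVal` and their bounds (`BakerField.lean`, `BakerModels.lean`, `SiegelEntries.lean`) and
Siegel's lemma over `𝓞 K` (`SiegelWrapper.lean`) we CONSTRUCT the auxiliary form and PROVE its
properties (`exists_auxiliary`): for parameters `D' , T ≥ 1, S₀` with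
`(S₀+1)·T·T^{dd} < (D'+1)^n` (`n = |β|+|γ|+|δ|`), there are algebraic integers `ξ_u ∈ 𝓞 K`, not
all zero, indexed by the exponents `u : (β ⊕ (γ ⊕ δ)) → {0,…,D'}`, of house
`≤ C_K (C_K q A)^{p/(q-p)}` (`A = houseBound`, explicit in `D = nD', T, S₀`), such that for
`Q = ∑_u ξ_u X^u` and the form `P = homog D Q`:

* `F_P = P(Θ) ≢ 0` (`NonVanishing.exists_thetaEval_homog_ne_zero`), and
* `F_P` vanishes to order `≥ T` along `𝔟 = ⟨x_1,…,x_dd⟩` at `s·v` for all `s ≤ S₀`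
  (`LineJetForms.vanishesAlong_span_of_wordForms`, `LineODEModel.wordForm_eq_map`): the linear
  system `sMat ξ = 0` solved by Siegel's lemma is exactly the vanishing of the word forms.

This is Lemma "construction of the auxiliary function" of Baker–Wüstholz §6.8 (pp. 118–119) for
the groups `M_κ` in the theta embedding.

## References

* A. Baker, G. Wüstholz, *Logarithmic Forms and Diophantine Geometry*, CUP 2007, §6.8.
* A. Baker, *Transcendental Number Theory*, CUP 1975, Ch. 2, Lemma 2.
-/

noncomputable section

open Complex MvPolynomial Finset NumberField
open Literature.NumberTheory.Transcendental.ArithPoly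
open Literature.NumberTheory.Transcendental.Chudnovsky
open scoped PeriodPair

namespace Literature.NumberTheory.Transcendental

namespace GaGmE

namespace Std

namespace BakerData

variable {β γ δ : Type} [Fintype β] [Fintype γ] [Fintype δ] [DecidableEq γ]
variable (B : BakerData β γ δ)

variable [DecidableEq β] [DecidableEq δ]

/-! ### The auxiliary form -/

/-- The polynomial `Q = ∑_u ξ_u X^{νOf u}` attached to a vector of coefficients. [folklore] -/
def QOf {D' : ℕ} (ξ : UIdx β γ δ D' → 𝓞 B.K) : MvPolynomial (β ⊕ (γ ⊕ δ)) ℂ :=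
  ∑ u, monomial (νOf u) (B.emb (ξ u : B.K))

omit [DecidableEq γ] [DecidableEq β] [DecidableEq δ] [Fintype β] [Fintype δ] in
/-- Sums of word forms. [folklore] -/
theorem wordForm_sum {L : PeriodPair} {κM : δ → γ → Kbar} {d : ℕ} (c : γ → Bool)
    (xs : Fin d → β ⊕ (γ ⊕ δ) → ℂ) (w : β ⊕ (γ ⊕ δ) → ℂ) {k : ℕ} (ω : Fin k → Fin d) {α : Type*}
    (s : Finset α) (P : α → MvPolynomial (Option β × ThetaIdx γ δ) ℂ) [DecidableEq γ] :
    wordForm L κM c xs w ω (∑ a ∈ s, P a) = ∑ a ∈ s, wordForm L κM c xs w ω (P a) := by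
  classical
  induction s using Finset.induction_on with
  | empty => simp [wordForm]
  | insert a s ha ih => rw [Finset.sum_insert ha, Finset.sum_insert ha, wordForm_add, ih]

/-- `coeff (νOf u) (QOf ξ) = ξ_u`. [folklore] -/
theorem coeff_QOf {D' : ℕ} (ξ : UIdx β γ δ D' → 𝓞 B.K) (u : UIdx β γ δ D') :
    coeff (νOf u) (B.QOf ξ) = B.emb (ξ u : B.K) := by
  rw [QOf, coeff_sum]
  simp only [coeff_monomial]
  rw [Finset.sum_eq_single u]
  · simp
  · intro u' _ hu'
    rw [if_neg]
    exact fun h => hu' (νOf_injective h)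
  · intro h; exact absurd (Finset.mem_univ u) h

/-- `QOf ξ ≠ 0` for `ξ ≠ 0`. [folklore] -/
theorem QOf_ne_zero {D' : ℕ} {ξ : UIdx β γ δ D' → 𝓞 B.K} (hξ : ξ ≠ 0) : B.QOf ξ ≠ 0 := by
  obtain ⟨u, hu⟩ := Function.ne_iff.mp hξ
  intro h
  have hc := B.coeff_QOf ξ u
  rw [h, coeff_zero] at hc
  have h1 : (ξ u : B.K) = 0 := by
    have : B.emb (ξ u : B.K) = 0 := hc.symm
    exact (map_eq_zero_iff B.emb (algebraMap B.K ℂ).injective).mp this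
  exact hu (RingOfIntegers.coe_eq_zero_iff.mp h1)

/-- `deg QOf ≤ n·D'`. [folklore] -/
theorem totalDegree_QOf_le {D' : ℕ} (ξ : UIdx β γ δ D' → 𝓞 B.K) :
    (B.QOf ξ).totalDegree ≤ Fintype.card (β ⊕ (γ ⊕ δ)) * D' := by
  rw [QOf]
  refine (totalDegree_finsetSum _ _).trans (Finset.sup_le fun u _ => ?_)
  refine (totalDegree_monomial_le _ _).trans ?_
  have h := degree_νOf_le u
  rw [Finsupp.degree] at h
  exact h

/-- `homog D (QOf ξ) = ∑_u ξ_u · homogMonomial D (νOf u)` (`D = nD'`). [folklore] -/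
theorem homog_QOf {D' : ℕ} (ξ : UIdx β γ δ D' → 𝓞 B.K) :
    homog (Fintype.card (β ⊕ (γ ⊕ δ)) * D') (B.QOf ξ) =
      ∑ u, C (B.emb (ξ u : B.K)) * homogMonomialᵣ (Fintype.card (β ⊕ (γ ⊕ δ)) * D') (νOf u) := by
  rw [QOf, homog_sum]
  exact Finset.sum_congr rfl fun u _ => homog_monomial (degree_νOf_le u) _

omit [DecidableEq β] [DecidableEq δ] in
/-- **The word forms of a homogenised monomial are the entries** (base change):
`Λ_ω(homogMonomial D ν)` at `s·v` in the chart `c_s` is `emb (entryVal s ω D ν)`. [folklore] -/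
theorem wordForm_homogMonomial (s D : ℕ) {k : ℕ} (ω : Fin k → Fin B.dd) (ν : (β ⊕ (γ ⊕ δ)) →₀ ℕ) :
    wordForm B.L B.κM (B.cAt s) B.xs ((s : ℂ) • B.v) ω (homogMonomialᵣ D ν) = B.emb (B.entryVal s ω D ν) := by
  have h := wordForm_eq_map (β := β) B.emb B.L B.κM (g2 := B.g2K) (g3 := B.g3K) rfl rfl (κ := B.κK)
    (fun _ _ => rfl) (B.cAt s) (xs := B.xs) (xK := B.xK) (fun _ _ => rfl) (w := (s : ℂ) • B.v)
    (gK := B.gK s) (fun i => B.emb_gK s 0 i) (P := homogMonomialᵣ D ν) (PK := homogMonomialᵣ D ν)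
    (map_homogMonomialᵣ _ _ _) ω
  rw [h]
  rfl

/-- **The Siegel system encodes the vanishing conditions**: if `sMat ξ = 0` then `F_{homog D (QOf ξ)}`
vanishes to order `≥ T` along `𝔟 = ⟨x_m⟩` at `s·v` for every `s ≤ S₀`.
[cite: BakerWustholz2007, §6.8 (p. 118)] -/
theorem vanishesAlong_of_mulVec {D' T S₀ : ℕ} {ξ : UIdx β γ δ D' → 𝓞 B.K}
    (h : (B.sMat D' T S₀).mulVec ξ = 0) {s : ℕ} (hs : s ≤ S₀) :
    VanishesAlong (Submodule.span ℂ (Set.range B.xs))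
      (thetaEval B.L B.κM (homog (Fintype.card (β ⊕ (γ ⊕ δ)) * D') (B.QOf ξ))) ((s : ℂ) • B.v) T := by
  set D := Fintype.card (β ⊕ (γ ⊕ δ)) * D' with hD
  refine vanishesAlong_span_of_wordForms B.L B.κM (isHomogeneous_homog D _) (B.cAt s)
    (fun x => zero_mem_chartDomain_chartChoiceAt B.L _ x) B.xs T fun k hk α => ?_
  -- the row of the system
  let α' : Fin B.dd → Fin T := fun m => ⟨α m, lt_of_lt_of_le (α m).isLt (Nat.succ_le_of_lt hk)⟩
  have hrow := B.rowSum_eq_zero_of_mulVec h (⟨s, Nat.lt_succ_of_le hs⟩, ⟨k, hk⟩, α')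
  simp only at hrow
  -- expand the word forms of `P = ∑_u ξ_u homogMonomial_u`
  have hP : ∀ ω : Fin k → Fin B.dd, wordForm B.L B.κM (B.cAt s) B.xs ((s : ℂ) • B.v) ω (homog D (B.QOf ξ)) =
      B.emb (∑ u, (ξ u : B.K) * B.entryVal s ω D (νOf u)) := by
    intro ω
    rw [homog_QOf, wordForm_sum, map_sum]
    refine Finset.sum_congr rfl fun u _ => ?_
    rw [← smul_eq_C_mul, wordForm_smul, wordForm_homogMonomial, map_mul]
  have hset : Finset.univ.filter (fun ω : Fin k → Fin B.dd => ∀ m, PolyODE.content ω m = α m) =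
      B.wordsOf k α' := by
    ext ω; simp [wordsOf, α']
  rw [Finset.sum_congr rfl fun ω _ => hP ω, ← map_sum, hset]
  rw [show ∑ ω ∈ B.wordsOf k α', ∑ u, (ξ u : B.K) * B.entryVal s ω D (νOf u) =
      ∑ u, (ξ u : B.K) * B.rowSum D s k α' (νOf u) from by
    rw [Finset.sum_comm]
    refine Finset.sum_congr rfl fun u _ => ?_
    rw [rowSum, Finset.mul_sum]]
  rw [hrow, map_zero]

/-! ### The auxiliary function -/

/-- Cardinality of the unknowns. [folklore] -/
theorem card_UIdx (D' : ℕ) : Fintype.card (UIdx β γ δ D') = (D' + 1) ^ Fintype.card (β ⊕ (γ ⊕ δ)) := by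
  simp [UIdx]

omit [DecidableEq β] [DecidableEq δ] in
/-- Cardinality of the equations. [folklore] -/
theorem card_EIdx (T S₀ : ℕ) : Fintype.card (B.EIdx T S₀) = (S₀ + 1) * (T * T ^ B.dd) := by
  simp [EIdx]

/-- **The auxiliary function of Baker's method on `M_κ`.** For `T ≥ 1` and parameters with
`(S₀+1)·T·T^{dd} < (D'+1)^n` there is a non-zero vector `ξ ∈ 𝓞 K^{unknowns}` of house
`≤ C_K (C_K q A)^{p/(q-p)}` (`A = houseBound`, `p, q` the two cardinalities) such that the form
`P = homog (nD') (QOf ξ)` satisfies: `F_P ≢ 0`, and `F_P` vanishes to order `≥ T` along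
`𝔟 = ⟨x_1, …, x_dd⟩` at all points `s·v`, `s ≤ S₀`. [cite: BakerWustholz2007, §6.8 (pp. 118–119)] -/
theorem exists_auxiliary (D' T S₀ : ℕ) (hT : 0 < T)
    (hpq : (S₀ + 1) * (T * T ^ B.dd) < (D' + 1) ^ Fintype.card (β ⊕ (γ ⊕ δ))) :
    ∃ ξ : UIdx β γ δ D' → 𝓞 B.K, ξ ≠ 0 ∧
      (∀ u, house ((ξ u : 𝓞 B.K) : B.K) ≤ siegelConst B.K *
        (siegelConst B.K * ((D' + 1) ^ Fintype.card (β ⊕ (γ ⊕ δ)) : ℕ) * B.houseBound D' T S₀) ^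
          ((((S₀ + 1) * (T * T ^ B.dd) : ℕ) : ℝ) /
            ((((D' + 1) ^ Fintype.card (β ⊕ (γ ⊕ δ)) : ℕ) : ℝ) - ((S₀ + 1) * (T * T ^ B.dd) : ℕ)))) ∧
      (∃ w, thetaEval B.L B.κM (homog (Fintype.card (β ⊕ (γ ⊕ δ)) * D') (B.QOf ξ)) w ≠ 0) ∧
      ∀ s ≤ S₀, VanishesAlong (Submodule.span ℂ (Set.range B.xs))
        (thetaEval B.L B.κM (homog (Fintype.card (β ⊕ (γ ⊕ δ)) * D') (B.QOf ξ))) ((s : ℂ) • B.v) T := by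
  have h0p : 0 < (S₀ + 1) * (T * T ^ B.dd) := Nat.mul_pos (Nat.succ_pos _) (Nat.mul_pos hT (pow_pos hT _))
  obtain ⟨ξ, hξ, hmul, hhouse⟩ := siegel_house B.K (B.sMat D' T S₀) h0p hpq (B.card_EIdx T S₀) (card_UIdx D')
    (B.one_le_houseBound D' T S₀) (fun r u => B.house_sMat_le D' T S₀ r u)
  refine ⟨ξ, hξ, fun u => hhouse u, ?_, fun s hs => B.vanishesAlong_of_mulVec hmul hs⟩
  exact exists_thetaEval_homog_ne_zero B.κM (B.QOf_ne_zero hξ) (B.totalDegree_QOf_le ξ)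

end BakerData

end Std

end GaGmE

end Literature.NumberTheory.Transcendental

end
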